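import Literature.AlgebraicGeometry.Motives.ProjectiveSpaceDehomogenize
import HarnessLib

/-!
# [OURS · tools] EXPLICIT HOMOGENISATION OF A FORM FROM ITS CHART: `P = Σₘ x_i^{e−m} · (P(x_i:=1))ₘ(x_{i.succAbove ·})`
# (toward the intrinsic «ordinary multiple points in general position» theorem of cruxes `EquisingularLiftNat(Three)` / `EquisingularLift`)

[OURS · leafhand-res-equisingularlift-7 g1, 2026-08-31; cell `pub/decomp-res`] AI-produced, weaker than expert review; NOT a statement of any manuscript.
DEF-FREE helper; no `sorry`; standard axioms.

The Literature file `ProjectiveSpaceDehomogenize` proves EXISTENCE of a homogeneous lift (`exists_isHomogeneous_dehomogenize_eq`) and UNIQUENESS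
(`eq_of_dehomogenize_eq`).  The next step of the ordinary-points programme (transport of the tangent cone `Φ` of a translated chart under a linear change
of coordinates fixing the point, see the census of `…OrdinaryPointAnywhere`) needs the EXPLICIT formula for a form in terms of the homogeneous
components of its own chart:

* `MultiOrd.totalDegree_dehomogenize_le` — `deg P(x_i := 1) ≤ e` for a form `P` of degree `e`;
* ★ `MultiOrd.eq_sum_X_pow_mul_rename_homogeneousComponent` — **`P = Σ_{m ≤ e} x_i^{e−m} · Qₘ(x_{i.succAbove ·})`** where `Q = P(x_i := 1)` and `Qₘ` is
  its homogeneous component of degree `m` (`R` a domain) — i.e. `P(t, y) = Σₘ t^{e−m} Qₘ(y)`: the expansion used to read the multiplicity and tangent cone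
  of `V₊(P)` at the vertex `e_i` off ANY line through it.

References: [Hartshorne1977, I §2, proof of Prop. 2.2 (maps `α`, `β`)].
-/

set_option linter.dupNamespace false -- mandated namespace `Summit.<Summit>.<Problem>` of this single-conjunct summit

noncomputable section

open MvPolynomial
open Literature.AlgebraicGeometry.Motives Literature.AlgebraicGeometry.Motives.ProjectiveSpace

namespace Summit.ResolutionOfSingularities.ResolutionOfSingularities.Cruxes.EquisingularLiftNat.Sections

namespace MultiOrd

variable {R : Type} [CommRing R] {n : ℕ} (i : Fin (n + 1))

/-- The substituted variables `x_i ↦ 1`, `x_{i.succAbove j} ↦ y_j` have total degree `≤ 1`. [folklore] -/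
theorem totalDegree_insertNth_le (s : Fin (n + 1)) :
    (Fin.insertNth (α := fun _ => MvPolynomial (Fin n) R) i 1 X s).totalDegree ≤ 1 := by
  rcases Fin.eq_self_or_eq_succAbove i s with rfl | ⟨j, rfl⟩
  · rw [Fin.insertNth_apply_same (α := fun _ => MvPolynomial (Fin n) R), totalDegree_one]
    exact zero_le_one
  · rw [Fin.insertNth_apply_succAbove (α := fun _ => MvPolynomial (Fin n) R), X]
    refine (totalDegree_monomial_le _ _).trans ?_
    simp

/-- **Dehomogenising a form of degree `e` gives a polynomial of total degree `≤ e`** (each monomial `x^α`, `|α| = e`, goes to a monomial of degree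
`|α| − α_i ≤ e`). [cite: Hartshorne1977, I §2, proof of Prop. 2.2] -/
theorem totalDegree_dehomogenize_le {e : ℕ} {P : MvPolynomial (Fin (n + 1)) R} (hP : P.IsHomogeneous e) :
    (ProjectiveSpace.dehomogenize R i P).totalDegree ≤ e := by
  classical
  conv_lhs => rw [P.as_sum]
  rw [map_sum]
  refine totalDegree_finsetSum_le fun α hα => ?_
  have hdeg : α.degree = e := by
    by_contra hne
    exact (mem_support_iff.mp hα) (hP.coeff_eq_zero hne)
  rw [monomial_eq, map_mul, ProjectiveSpace.dehomogenize, aeval_C, map_finsuppProd]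
  refine (totalDegree_mul _ _).trans ?_
  rw [MvPolynomial.algebraMap_eq, totalDegree_C, zero_add]
  refine (totalDegree_finsetProd _ _).trans ?_
  rw [← hdeg, Finsupp.degree_apply]
  refine Finset.sum_le_sum fun s _ => ?_
  dsimp only
  rw [map_pow, aeval_X]
  refine (totalDegree_pow _ _).trans ?_
  calc α s * (Fin.insertNth (α := fun _ => MvPolynomial (Fin n) R) i 1 X s).totalDegree ≤ α s * 1 :=
        Nat.mul_le_mul_left _ (totalDegree_insertNth_le i s)
    _ = α s := mul_one _

/-- ★ **Explicit homogenisation of a form from its chart**: for a form `P` of degree `e` over a domain and `Q = P(x_i := 1)`,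
`P = Σ_{m ≤ e} x_i^{e−m} · Qₘ(x_{i.succAbove ·})`, `Qₘ` the homogeneous component of degree `m` of `Q` — both sides are forms of degree `e` with the same
dehomogenisation (✓ `eq_of_dehomogenize_eq`; the computation of ✓ `exists_isHomogeneous_dehomogenize_eq`). [cite: Hartshorne1977, I §2, proof of Prop. 2.2] -/
theorem eq_sum_X_pow_mul_rename_homogeneousComponent [IsDomain R] {e : ℕ} {P : MvPolynomial (Fin (n + 1)) R}
    (hP : P.IsHomogeneous e) :
    P = ∑ m ∈ Finset.range (e + 1),
      X i ^ (e - m) * rename i.succAbove (homogeneousComponent m (ProjectiveSpace.dehomogenize R i P)) := by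
  set g := ProjectiveSpace.dehomogenize R i P with hg
  have he : g.totalDegree ≤ e := totalDegree_dehomogenize_le i hP
  refine ProjectiveSpace.eq_of_dehomogenize_eq i hP ?_ ?_
  · refine IsHomogeneous.sum _ _ _ fun m hm => ?_
    have hm' : m ≤ e := Nat.lt_succ_iff.mp (Finset.mem_range.mp hm)
    have h1 : (X i ^ (e - m) : MvPolynomial (Fin (n + 1)) R).IsHomogeneous (1 * (e - m)) :=
      (isHomogeneous_X R i).pow (e - m)
    have h2 : (rename i.succAbove (homogeneousComponent m g)).IsHomogeneous m :=
      (homogeneousComponent_isHomogeneous m g).rename_isHomogeneous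
    have := h1.mul h2
    rwa [one_mul, Nat.sub_add_cancel hm'] at this
  · rw [map_sum]
    have hterm : ∀ m ∈ Finset.range (e + 1), ProjectiveSpace.dehomogenize R i
        (X i ^ (e - m) * rename i.succAbove (homogeneousComponent m g)) = homogeneousComponent m g := fun m _ => by
      rw [map_mul, map_pow, ProjectiveSpace.dehomogenize_X_self, one_pow, one_mul, ProjectiveSpace.dehomogenize_rename_succAbove]
    rw [Finset.sum_congr rfl hterm]
    rw [← Finset.sum_subset (Finset.range_subset_range.mpr (Nat.succ_le_succ he))
      (fun m _ hm => homogeneousComponent_eq_zero m g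
        (by have := Finset.mem_range.not.mp hm; omega))]
    exact (sum_homogeneousComponent g).symm

end MultiOrd

end Summit.ResolutionOfSingularities.ResolutionOfSingularities.Cruxes.EquisingularLiftNat.Sections

end
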